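import Summits.QuantumFields.BalabanUV.Beta.FP.PerfectBubbleExpansion
import Summits.QuantumFields.BalabanUV.Beta.D1BFx.DressedTablesLeg
import Summits.QuantumFields.BalabanUV.Beta.FP.StepLawKHolds
import Summits.QuantumFields.BalabanUV.Beta.FP.SymmetryK
import Literature.MathematicalPhysics.QuantumFieldTheory.Balaban1983to89.Beta.StepDriftWitness

/-!
# `BalabanUV.Beta.FP.PerfectBubbleSandwich` — road «FP» for binder row D1, leaf N7 ∕ `hrep` (REP∞), sub-leaf ALG-2 «periodic transport»
# of the owner's `REP-DESIGN.md`, in the EXACT form (fine Ward rows + parity as hypotheses): THE BUBBLE HALF OF THE PERFECT ONE-LOOP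
# KERNEL `TPerfOf n K S W` IS THE SANDWICH `colHᵀ · P^Π · colH` OF THE FINE BUBBLE TABLE `P^Π := bubbleTableA (Π K Π) (Πᵀ S)` BY THE
# PERFECT COLUMN ITSELF, AND (K-R5, `d = 4`) ITS COARSE BOND SECOND MOMENT EQUALS THE BASE-POINT AVERAGE OF THE FINE SECOND MOMENT

HONEST FRAMING (cell contract, verbatim): «discharging `BetaPertH` makes Bałaban's UV stability UNCONDITIONAL — a real
constructive-QFT result; it is NOT the continuum limit and NOT the Clay problem.»  [folklore] bookkeeping composed BY NAME from the tree:
the bond-slot adjunction `AxialDressing.vertexOfK_coProj_eq` (`axVertexOfK K n S = vertexOfK K n (Πᵀ S)`: the `Π` on the weights moves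
onto the stencil index, so the weights of the bubble expansion are the UNDRESSED perfect column `u ↦ K u 0 (inl κ′) (inr μ)`), ALG-1
`PerfectBubbleExpansion.bubble_vertexOfK`, `AxialProjector.axProj_shift` (the `Π`-twins `legAx₁∕₂_shiftK` of `AxialDressing.legCo₁∕₂_shiftK`),
road BF-x's generic-leg tables `D1BFx.DressedTablesLeg.bubbleTableA` (+ `exists_decay_bubbleTableA`, `absMoment₂_baseKer_bubbleTableA`,
`bubbleTableA_transpose`) and leaf K-R5 `D1BFx.MomentTransferPeriodicEntry.bondSecondMomentP_tsum_four` (generic weights), the reflection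
`StepDriftWitness.constReproSum_reflect`, and road FP's K-side facts `FP/StepLawKHolds.entryHyps_perfCol_holds` ∕ `exists_decays_KPerf_holds`,
`FP/SymmetryK.shiftK_KPerf`.  No definition, no `def … : Prop`, nothing cited, nothing of the manuscripts under audit asserted; the fine
WARD ROWS `hrow` and the base-point-summed FIRST MOMENTS `hT1` of `P^Π` stay HYPOTHESES (N3-type per-base-point data; the owner's
«T0∕T1-defects» variant is the nine-term identity `MomentTransferPeriodicMaster.hasSum_termP_second`, not instantiated here); 0 estimates of
leaf N7 proved; 0∕4 binders of row D1.  Value = kernel bookkeeping for road FP (`REP-DESIGN.md` row ALG-2; claim table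
`HOME/b2b-balaban-beta-d1-p3/LEAVES-FP.md` sub-row REP-ALG-2), NOT summit progress; NOT `hasym`, NOT D1, NOT BetaPertH, NOT continuum, NOT Clay.
HONEST DEPENDENCY (verbatim): continuum YM on T⁴ ⇐ BetaPertH ∧ nine spine estimates (0/9 proved); BetaPertH ⇐ (D1) ∧ (D4) ∧
CAP+tail; G-an2-4 gates asym, D1 and NE2/3/4.

UNITS BOOKKEEPING CONSTANT (the owner's «Units check», reported, not hidden): in the adopted units the identity of §5 reads
`Σ'_z z_κ z_λ · n⁸ · (−½·bubble half of TPerfOf)(z) = avgM2 n (P^Π μ ν) κ λ`, `avgM2 n Q κ λ = n⁻⁴ · Σ_{b ∈ box n} Σ'_t t_κ t_λ Q (b+t) b` —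
i.e. in `B12Beta.secondMoment` currency the bubble half of `fPerf … m` is `n⁻⁸ × (base-point AVERAGE of the fine second moment of P^Π)`,
`n = Lc^m`, with the weights' Kronecker coset mass `n⁻⁵` (`EntryHyps.const`) already consumed by K-R5's `d = 4` equality.  Whether
`n⁻⁸ · avgM2 n (P^Π μ ν)` is `n`-free is EXACTLY the content of the legs ∕ germs rows (LEGS, GERM-K, GERM-S) — not asserted here.

CONTENT (all [folklore]):
* §1 `legAx₁_shiftK`, `legAx₂_shiftK`, `axDressK_shiftK`, `axDressK_blockCov` (`Π K Π` inherits coarse-translation invariance).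
* §2 `coProj_translate` (`Πᵀ S` inherits coarse-translation covariance), `isBlockPeriodic_bubbleTableA_coarse` (block periodicity of the
  bubble table from COARSE covariance only).
* §3 `colH_zero_eq_colOf_neg`, `linReproSum_reflect`, `absMoment₂_reflect`, `constReproSum_colH_zero`, `linReproSum_colH_zero`,
  `absMoment₂_colH_zero` (the three `EntryHyps` letters transferred from `colOf K` to the base-`0` column `colH K n · 0 ·`).
* §4 (the literal perfect shape, `d = 3`) **`bubble_TPerfOf_vertices_coProj`** (ALG-1 with UNDRESSED weights and `Πᵀ`-stencils),
  **`bubblePart_TPerfOf_eq_dressedEntryP`** (`−½·bubble (Π K Π) (V μ 0) (V ν z) = dressedEntryP (colH K n · 0 ·) P^Π (n•(−z)) μ ν`).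
* §5 **`bondSecondMoment_bubblePart_TPerfOf_eq_avgM2`** ∕ **`secondMoment_bubblePart_TPerfOf_eq`** (K-R5 with generic weights: GIVEN
  `hrow`, `hT1` of `P^Π`, the coarse bond second moment of the bubble half of `TPerfOf` is `avgM2`; `secondMoment` form with `n⁻⁸`).
* §6 **`secondMoment_bubblePart_perfect_eq`** — the same at `K := KPerf Lc (sfStep Lc) (smStep 3 Lc) m`, `n := Lc^m`, `2 ≤ Lc`, `1 ≤ m`,
  with EVERY K-side hypothesis DISCHARGED from the tree (decay, coarse covariance, `EntryHyps` letters); remaining: `S`-side class data +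
  coarse covariance, `hrow`, `hT1`.
-/

namespace Summit.QuantumFields.BalabanUV.Beta.FP.PerfectBubbleSandwich

open Finset
open scoped BigOperators
open Literature.MathematicalPhysics.QuantumFieldTheory.Balaban1983to89
open Literature.MathematicalPhysics.QuantumFieldTheory.Balaban1983to89.Beta
open B12Sec2to5 (l1 l1_nonneg Decay510)
open ExpKernelCalculus (Site MKer Decays BiLoc comp tr bubble tadpole hessKer VertexFamily VertexFamily₂ shiftK bubble_shiftK)
open DecimatedMoment (cosetInd cosetInd_neg)
open DecimatedMomentSummable (AbsMoment₂ ConstReproSum LinReproSum absMoment₂_of_decay510)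
open DressedMomentNormalisation (EKer resSite EntryHyps)
open OneStepResolventKernel (Fib wsum LocStencil)
open OneStepKernelFamily (colH vertexOfK abs_colH_le)
open AveragingContours (shift)
open AxialProjector (axProj coProj axProj_shift)
open AxialDressing (legAx₁ legAx₂ legAx₁_inl legAx₁_inr legAx₂_inl legAx₂_inr axDressK axVertexOfK decays_axDressK coProj_shift
  coProj_shiftK vertexOfK_coProj_eq locStencil_coProj cN')
open StepDriftWitness (constReproSum_reflect)
open Summit.QuantumFields.BalabanUV.Beta.TameKernelCalculus
open Summit.QuantumFields.BalabanUV.Beta.GAN24.CombesThomas (sfStep smStep)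
open Summit.QuantumFields.BalabanUV.Beta.D1BFx.DressedBubbleBridge (spr_of_loc)
open Summit.QuantumFields.BalabanUV.Beta.D1BFx.MomentTransferPeriodic (Ker₂ IsBlockPeriodic baseKer)
open Summit.QuantumFields.BalabanUV.Beta.D1BFx.MomentTransferPeriodicSum (dressedSumP)
open Summit.QuantumFields.BalabanUV.Beta.D1BFx.MomentTransferPeriodicEntry (EKer₂ dressedEntryP avgM2 bondSecondMomentP_tsum_four)
open Summit.QuantumFields.BalabanUV.Beta.D1BFx.DressedTablesLeg (bubbleTableA bubbleTableA_apply bubbleTableA_transpose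
  exists_decay_bubbleTableA absMoment₂_baseKer_bubbleTableA)
open Summit.QuantumFields.BalabanUV.Beta.FP.PerfectObjectsT (KPerf SPerfOf WPerfOf TPerfOf fPerf)
open Summit.QuantumFields.BalabanUV.Beta.FP.TransportInfinityM (colOf colOf_apply)
open Summit.QuantumFields.BalabanUV.Beta.FP.StepLawKHolds (entryHyps_perfCol_holds exists_decays_KPerf_holds)
open Summit.QuantumFields.BalabanUV.Beta.FP.SymmetryK (shiftK_KPerf)
open Summit.QuantumFields.BalabanUV.Beta.FP.PerfectBubbleExpansion (bubble_vertexOfK colH_of_blockCov)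

noncomputable section

/-! ## §1 `Π` on the legs commutes with coarse shifts -/

section AxShift

variable {d : ℕ}

/-- [folklore] **`Π` ON THE FIRST LEG COMMUTES WITH SIMULTANEOUS COARSE SHIFTS** (`N•t`) of the kernel arguments
(`AxialProjector.axProj_shift`; the `Π`-twin of `AxialDressing.legCo₁_shiftK`). -/
theorem legAx₁_shiftK {N : ℕ} (hN : 1 ≤ N) (K : MKer (d + 1) (Fib d)) (t : Fin (d + 1) → ℤ) :
    legAx₁ N (shiftK ((N : ℤ) • t) K) = shiftK ((N : ℤ) • t) (legAx₁ N K) := by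
  funext x y a b
  cases a with
  | inr m => rfl
  | inl α =>
    show axProj N (fun α' x' => K (x' + (N : ℤ) • t) (y + (N : ℤ) • t) (Sum.inl α') b) α x =
      axProj N (fun α' x' => K x' (y + (N : ℤ) • t) (Sum.inl α') b) α (x + (N : ℤ) • t)
    have h := axProj_shift hN (fun α' x' => K x' (y + (N : ℤ) • t) (Sum.inl α') b) t
    exact congrFun (congrFun h α) x

/-- [folklore] **`Π` ON THE SECOND LEG COMMUTES WITH SIMULTANEOUS COARSE SHIFTS.** -/
theorem legAx₂_shiftK {N : ℕ} (hN : 1 ≤ N) (K : MKer (d + 1) (Fib d)) (t : Fin (d + 1) → ℤ) :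
    legAx₂ N (shiftK ((N : ℤ) • t) K) = shiftK ((N : ℤ) • t) (legAx₂ N K) := by
  funext x y a b
  cases b with
  | inr m => rfl
  | inl β =>
    show axProj N (fun β' y' => K (x + (N : ℤ) • t) (y' + (N : ℤ) • t) a (Sum.inl β')) β y =
      axProj N (fun β' y' => K (x + (N : ℤ) • t) y' a (Sum.inl β')) β (y + (N : ℤ) • t)
    have h := axProj_shift hN (fun β' y' => K (x + (N : ℤ) • t) y' a (Sum.inl β')) t
    exact congrFun (congrFun h β) y

/-- [folklore] **THE `Π`-CONJUGATED KERNEL COMMUTES WITH COARSE SHIFTS**: `Π (shiftK (N•t) K) Π = shiftK (N•t) (Π K Π)`. -/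
theorem axDressK_shiftK {N : ℕ} (hN : 1 ≤ N) (K : MKer (d + 1) (Fib d)) (t : Fin (d + 1) → ℤ) :
    axDressK N (shiftK ((N : ℤ) • t) K) = shiftK ((N : ℤ) • t) (axDressK N K) := by
  show legAx₁ N (legAx₂ N (shiftK ((N : ℤ) • t) K)) = shiftK ((N : ℤ) • t) (legAx₁ N (legAx₂ N K))
  rw [legAx₂_shiftK hN, legAx₁_shiftK hN]

/-- [folklore] **`Π K Π` INHERITS COARSE-TRANSLATION INVARIANCE**: `shiftK (−N•t) K = K ∀ t` ⟹ the same for `axDressK N K`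
(the `hA`∕`hAcov` socket of `DressedTablesLeg` at the leg `Π K Π`). -/
theorem axDressK_blockCov {N : ℕ} (hN : 1 ≤ N) {K : MKer (d + 1) (Fib d)}
    (hKcov : ∀ t : Fin (d + 1) → ℤ, shiftK (-((N : ℤ) • t)) K = K) (t : Fin (d + 1) → ℤ) :
    shiftK (-((N : ℤ) • t)) (axDressK N K) = axDressK N K := by
  have h := axDressK_shiftK hN K (-t)
  rw [smul_neg] at h
  rw [← h, hKcov t]

end AxShift

/-! ## §2 `Πᵀ S` inherits coarse covariance; block periodicity of the bubble table from coarse covariance -/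

section Coarse

variable {d : ℕ}

/-- [folklore] **THE `covS` SOCKET SURVIVES `Πᵀ`**: if `S κ (u + N•t) = shiftK (−N•t) (S κ u)` (coarse-translation covariance of a stencil
family) then `coProj N S` obeys the same law (`AxialDressing.coProj_shift` + `coProj_shiftK`; the kernel-dressing-free half of
`AxialDressing.dressS_translate`). -/
theorem coProj_translate {N : ℕ} (hN : 1 ≤ N) {S : Fin (d + 1) → (Fin (d + 1) → ℤ) → MKer (d + 1) (Fib d)}
    (hS : ∀ κ u t, S κ (u + (N : ℤ) • t) = shiftK (-((N : ℤ) • t)) (S κ u)) (κ : Fin (d + 1)) (u t : Fin (d + 1) → ℤ) :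
    coProj N S κ (u + (N : ℤ) • t) = shiftK (-((N : ℤ) • t)) (coProj N S κ u) := by
  have h1 : coProj N S κ (u + (N : ℤ) • t) = coProj N (fun κ' u' => S κ' (u' + (N : ℤ) • t)) κ u :=
    (coProj_shift hN S t κ u).symm
  have h2 : (fun κ' u' => S κ' (u' + (N : ℤ) • t)) = fun κ' u' => shiftK (-((N : ℤ) • t)) (S κ' u') := by
    funext κ' u'
    exact hS κ' u' t
  rw [h1, h2, coProj_shiftK]

variable {F : Type*} [Fintype F]

/-- [folklore] **BLOCK PERIODICITY OF THE BUBBLE TABLE FROM COARSE COVARIANCE ONLY**: a block-covariant leg (`shiftK (−n•t) A = A`) and a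
COARSE-translation-covariant stencil family (`S κ′ (u + n•t) = shiftK (−n•t) (S κ′ u)` — all that `Πᵀ S` retains) give a block-periodic
`bubbleTableA A S` (`DressedTablesLeg.isBlockPeriodic_bubbleTableA` asks fine covariance but uses it only at `v = n•t`). -/
theorem isBlockPeriodic_bubbleTableA_coarse {n : ℕ} {A : MKer 4 F} (hA : ∀ t : Site 4, shiftK (-((n : ℤ) • t)) A = A)
    {S : Fin 4 → Site 4 → MKer 4 F} (hS : ∀ (κ' : Fin 4) (u t : Site 4), S κ' (u + (n : ℤ) • t) = shiftK (-((n : ℤ) • t)) (S κ' u))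
    (κ' l' : Fin 4) : IsBlockPeriodic n (bubbleTableA A S κ' l') := by
  intro t s s'
  simp only [bubbleTableA_apply]
  rw [hS κ' s t, hS l' s' t]
  conv_lhs => rw [← hA t]
  rw [bubble_shiftK]

end Coarse

/-! ## §3 The `EntryHyps` letters of the base-`0` column from those of `colOf` (one reflection `u ↦ −u`) -/

section Letters

variable {d : ℕ}

/-- [folklore] The base-`0` `ℋ`-column IS the reflected `colOf`: `colH K n a 0 c u = colOf K c a (−u)` (`colOf K c a p = K (−p) 0 (inl c) (inr a)`). -/
theorem colH_zero_eq_colOf_neg (K : MKer (3 + 1) (Fib 3)) (n : ℕ) (a c : Fin (3 + 1)) (u : Fin (3 + 1) → ℤ) :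
    colH K n a 0 c u = colOf K c a (-u) := by
  simp only [OneStepKernelFamily.colH, colOf_apply, smul_zero, neg_neg]

/-- [folklore] Linear reproduction through `N•ℤ^d` under the reflection `u ↦ −u` of the pattern (constants `C ↦ −C`). -/
theorem linReproSum_reflect {N : ℕ} {f : (Fin d → ℤ) → ℝ} {C : Fin d → ℝ} (h : LinReproSum N f C) :
    LinReproSum N (fun u => f (-u)) (fun κ => -C κ) := by
  intro a κ
  have e : (fun u : Fin d → ℤ => (cosetInd N (a - u) * u κ) • f (-u))
      = (fun u : Fin d → ℤ => -((cosetInd N (-a - u) * u κ) • f u)) ∘ (Equiv.neg (Fin d → ℤ)) := by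
    funext u
    simp only [Function.comp_apply, Equiv.neg_apply, Pi.neg_apply, zsmul_eq_mul, Int.cast_mul, Int.cast_neg]
    rw [← cosetInd_neg N (a - u), show -(a - u) = -a - -u by abel]
    ring
  rw [e]
  exact (Equiv.neg (Fin d → ℤ)).hasSum_iff.2 ((h (-a) κ).neg)

/-- [folklore] Absolutely summable second moments under the reflection `u ↦ −u` (`|−u|₁ = |u|₁`). -/
theorem absMoment₂_reflect {f : (Fin d → ℤ) → ℝ} (h : AbsMoment₂ f) : AbsMoment₂ (fun u => f (-u)) := by
  unfold DecimatedMomentSummable.AbsMoment₂ at h ⊢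
  have hl : ∀ y : Fin d → ℤ, l1 (-y) = l1 y := fun y => by
    unfold B12Sec2to5.l1
    simp only [Pi.neg_apply, Int.cast_neg, abs_neg]
  have e : (fun y : Fin d → ℤ => (1 + l1 y ^ 2) * |f (-y)|) = (fun y => (1 + l1 y ^ 2) * |f y|) ∘ (Equiv.neg (Fin d → ℤ)) := by
    funext y
    simp only [Function.comp_apply, Equiv.neg_apply, hl]
  rw [e]
  exact (Equiv.neg (Fin d → ℤ)).summable_iff.2 h

/-- [folklore] (L0∞) for the base-`0` column from (L0∞) for `colOf` (same Kronecker masses). -/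
theorem constReproSum_colH_zero {K : MKer (3 + 1) (Fib 3)} {n : ℕ} {σ : Fin 4 → Fin 4 → ℝ}
    (h : ∀ κ l, ConstReproSum n (colOf K κ l) (σ κ l)) (κ l : Fin 4) : ConstReproSum n (colH K n l 0 κ) (σ κ l) := by
  have e : colH K n l 0 κ = fun u => colOf K κ l (-u) := funext fun u => colH_zero_eq_colOf_neg K n l κ u
  rw [e]
  exact constReproSum_reflect (h κ l)

/-- [folklore] (L1∞) for the base-`0` column from (L1∞) for `colOf`. -/
theorem linReproSum_colH_zero {K : MKer (3 + 1) (Fib 3)} {n : ℕ} (h : ∀ κ l, ∃ C : Fin 4 → ℝ, LinReproSum n (colOf K κ l) C)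
    (κ l : Fin 4) : ∃ C : Fin 4 → ℝ, LinReproSum n (colH K n l 0 κ) C := by
  obtain ⟨C, hC⟩ := h κ l
  have e : colH K n l 0 κ = fun u => colOf K κ l (-u) := funext fun u => colH_zero_eq_colOf_neg K n l κ u
  rw [e]
  exact ⟨_, linReproSum_reflect hC⟩

/-- [folklore] Absolutely summable second moments of the base-`0` column from those of `colOf`. -/
theorem absMoment₂_colH_zero {K : MKer (3 + 1) (Fib 3)} {n : ℕ} (h : ∀ κ l, AbsMoment₂ (colOf K κ l)) (κ l : Fin 4) :
    AbsMoment₂ (colH K n l 0 κ) := by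
  have e : colH K n l 0 κ = fun u => colOf K κ l (-u) := funext fun u => colH_zero_eq_colOf_neg K n l κ u
  rw [e]
  exact absMoment₂_reflect (h κ l)

end Letters

/-! ## §4 The sandwich form of the bubble half of `TPerfOf` -/

section Sandwich

variable {n : ℕ} {K : MKer (3 + 1) (Fib 3)} {C δ : ℝ} {S : Fin (3 + 1) → (Fin (3 + 1) → ℤ) → MKer (3 + 1) (Fib 3)} {Cs δs : ℝ}

/-- [folklore] **ALG-1 WITH UNDRESSED WEIGHTS AND `Πᵀ`-STENCILS** (bond-slot adjunction `AxialDressing.vertexOfK_coProj_eq` + ALG-1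
`PerfectBubbleExpansion.bubble_vertexOfK` at the local family `Πᵀ S`, `AxialDressing.locStencil_coProj`):
`bubble (Π K Π) (axVertexOfK K n S μ y) (axVertexOfK K n S ν y′)
   = Σ_{κ′λ′} Σ'_{(u,u′)} colH K n μ y κ′ u · colH K n ν y′ λ′ u′ · bubble (Π K Π) (Πᵀ S κ′ u) (Πᵀ S λ′ u′)`. -/
theorem bubble_TPerfOf_vertices_coProj (hn : 1 ≤ n) (hK : Decays K C δ) (hδ : 0 < δ) (hS : LocStencil S Cs δs) (hδs : 0 < δs)
    (μ ν : Fin (3 + 1)) (y y' : Fin (3 + 1) → ℤ) :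
    bubble (axDressK n K) (axVertexOfK K n S μ y) (axVertexOfK K n S ν y')
      = ∑ κ' : Fin (3 + 1), ∑ l' : Fin (3 + 1), ∑' q : (Fin (3 + 1) → ℤ) × (Fin (3 + 1) → ℤ),
          colH K n μ y κ' q.1 * colH K n ν y' l' q.2 * bubble (axDressK n K) (coProj n S κ' q.1) (coProj n S l' q.2) := by
  rw [← vertexOfK_coProj_eq hn hK hδ hS hδs.le μ y, ← vertexOfK_coProj_eq hn hK hδ hS hδs.le ν y']
  exact bubble_vertexOfK ⟨_, δ, hδ, decays_axDressK hn hK hδ.le⟩ hK hδ (locStencil_coProj hn hS hδs.le) hδs μ ν y y'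

/-- [folklore] **THE BUBBLE HALF OF `TPerfOf` IS THE SANDWICH OF THE FINE BUBBLE TABLE BY THE PERFECT COLUMN** (road-FP twin of
`D1BFx.DressedTablesLeg.bubblePartA_eq_dressedEntryP`): for a decaying, coarse-translation-invariant `K` and a local, coarse-translation-covariant
stencil family `S` (blocking `n ≥ 1`),
`−½·bubble (Π K Π) (axVertexOfK K n S μ 0) (axVertexOfK K n S ν z) = dressedEntryP (c a ↦ colH K n a 0 c) (bubbleTableA (Π K Π) (Πᵀ S)) (n•(−z)) μ ν`
— coarse covariance of the second weight (`PerfectBubbleExpansion.colH_of_blockCov`), re-indexing `u′ = x + n•z`, block periodicity (§2). -/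
theorem bubblePart_TPerfOf_eq_dressedEntryP (hn : 1 ≤ n) (hK : Decays K C δ) (hδ : 0 < δ)
    (hKcov : ∀ t : Fin (3 + 1) → ℤ, shiftK (-((n : ℤ) • t)) K = K) (hS : LocStencil S Cs δs) (hδs : 0 < δs)
    (hScov : ∀ κ u t, S κ (u + (n : ℤ) • t) = shiftK (-((n : ℤ) • t)) (S κ u)) (μ ν : Fin (3 + 1)) (z : Fin (3 + 1) → ℤ) :
    -(1 / 2 : ℝ) * bubble (axDressK n K) (axVertexOfK K n S μ 0) (axVertexOfK K n S ν z)
      = dressedEntryP (fun c a => colH K n a 0 c) (bubbleTableA (axDressK n K) (coProj n S)) ((n : ℤ) • (-z)) μ ν := by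
  rw [bubble_TPerfOf_vertices_coProj hn hK hδ hS hδs μ ν 0 z, Finset.mul_sum]
  simp only [dressedEntryP, dressedSumP]
  refine Finset.sum_congr rfl fun κ' _ => ?_
  rw [Finset.mul_sum]
  refine Finset.sum_congr rfl fun l' _ => ?_
  rw [← tsum_mul_left]
  rw [← (Equiv.prodCongr (Equiv.refl (Fin (3 + 1) → ℤ)) (Equiv.addRight ((n : ℤ) • z))).tsum_eq]
  refine tsum_congr fun q => ?_
  obtain ⟨u, x⟩ := q
  simp only [Equiv.prodCongr_apply, Prod.map_apply, Equiv.refl_apply, Equiv.coe_addRight]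
  have hper := isBlockPeriodic_bubbleTableA_coarse (axDressK_blockCov hn hKcov) (coProj_translate hn hScov) κ' l' (-z) u
    (x + (n : ℤ) • z)
  rw [bubbleTableA_apply, bubbleTableA_apply, smul_neg, show x + (n : ℤ) • z + -((n : ℤ) • z) = x by abel] at hper
  rw [colH_of_blockCov hKcov ν z l' (x + (n : ℤ) • z), add_sub_cancel_right, bubbleTableA_apply,
    show (n : ℤ) • -z + u = u + -((n : ℤ) • z) by rw [smul_neg]; abel, hper]
  ring

end Sandwich

/-! ## §5 K-R5 with the perfect column as weight: coarse bond second moment = base-point average -/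

section Transport

variable {n : ℕ} {K : MKer (3 + 1) (Fib 3)} {C δ : ℝ} {S : Fin (3 + 1) → (Fin (3 + 1) → ℤ) → MKer (3 + 1) (Fib 3)} {Cs δs : ℝ}

/-- [folklore] Rows summing to zero for EVERY entry ⟹ columns summing to zero for every entry (matrix symmetry of the bubble table over the
spread leg `Π K Π` and the local family `Πᵀ S`). -/
theorem hasSum_col_bubbleTableA (hn : 1 ≤ n) (hK : Decays K C δ) (hδ : 0 < δ) (hS : LocStencil S Cs δs) (hδs : 0 < δs)
    (hrow : ∀ (κ' l' : Fin 4) (b : Site 4), HasSum (bubbleTableA (axDressK n K) (coProj n S) κ' l' b) 0)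
    (κ' l' : Fin 4) (b : Site 4) : HasSum (fun s => bubbleTableA (axDressK n K) (coProj n S) κ' l' s b) 0 :=
  (hrow l' κ' b).congr_fun fun s => bubbleTableA_transpose (axDressK n K) ⟨_, δ, hδ, decays_axDressK hn hK hδ.le⟩
    (fun κ u => locStencil_coProj hn hS hδs.le κ u) hδs κ' l' s b

/-- [folklore] **ALG-2, EXACT FORM — THE COARSE BOND SECOND MOMENT OF THE BUBBLE HALF OF `TPerfOf` IS THE BASE-POINT AVERAGE OF THE FINE
SECOND MOMENT OF `P^Π`.**  Decaying, coarse-translation-invariant `K` whose column `colOf K` carries the three `EntryHyps` letters (Kronecker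
coset masses `n⁻⁵`, affine reproduction, absolutely summable second moments — for the perfect resolvent: `FP/StepLawKHolds.entryHyps_perfCol_holds`);
local, coarse-translation-covariant `S`; GIVEN that every entry of `P^Π := bubbleTableA (Π K Π) (Πᵀ S)` has ROWS SUMMING TO ZERO (`hrow`) and
BASE-POINT-SUMMED FIRST MOMENTS ZERO (`hT1`):
`Σ'_z z_κ z_λ · n⁸ · (−½·bubble (Π K Π) (V μ 0) (V ν z)) = avgM2 n (P^Π μ ν) κ λ`, `V := axVertexOfK K n S` — NO cross term survives
(K-R5 `MomentTransferPeriodicEntry.bondSecondMomentP_tsum_four` with the generic weights `c a ↦ colH K n a 0 c`). -/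
theorem bondSecondMoment_bubblePart_TPerfOf_eq_avgM2 (hn : 1 ≤ n) (hK : Decays K C δ) (hδ : 0 < δ)
    (hKcov : ∀ t : Fin (3 + 1) → ℤ, shiftK (-((n : ℤ) • t)) K = K)
    (hw0 : ∀ κ l : Fin 4, ConstReproSum n (colOf K κ l) (if κ = l then (((n : ℝ) ^ (4 + 1))⁻¹) else 0))
    (hw1 : ∀ κ l : Fin 4, ∃ C : Fin 4 → ℝ, LinReproSum n (colOf K κ l) C) (hwA : ∀ κ l : Fin 4, AbsMoment₂ (colOf K κ l))
    (hS : LocStencil S Cs δs) (hδs : 0 < δs) (hScov : ∀ κ u t, S κ (u + (n : ℤ) • t) = shiftK (-((n : ℤ) • t)) (S κ u))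
    (hrow : ∀ (κ' l' : Fin 4) (b : Site 4), HasSum (bubbleTableA (axDressK n K) (coProj n S) κ' l' b) 0)
    (hT1 : ∀ (κ' l' μ' : Fin 4), ∑ r : Fin 4 → Fin n, ∑' t, (t μ' : ℝ) *
      baseKer (bubbleTableA (axDressK n K) (coProj n S) κ' l') (resSite r) t = 0)
    (κ lam μ ν : Fin 4) :
    ∑' z : Site 4, ((z κ * z lam : ℤ) : ℝ) *
        ((n : ℝ) ^ 8 * (-(1 / 2 : ℝ) * bubble (axDressK n K) (axVertexOfK K n S μ 0) (axVertexOfK K n S ν z)))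
      = avgM2 n (bubbleTableA (axDressK n K) (coProj n S) μ ν) κ lam := by
  have hA : Spr (axDressK n K) := ⟨_, δ, hδ, decays_axDressK hn hK hδ.le⟩
  have hS' : ∀ κ u, BiLoc (coProj n S κ u) u u (cN' 3 n δs * Cs) δs := fun κ u => locStencil_coProj hn hS hδs.le κ u
  have h := bondSecondMomentP_tsum_four (N := n) (by omega) (fun c a => colH K n a 0 c) (bubbleTableA (axDressK n K) (coProj n S))
    (fun c e => isBlockPeriodic_bubbleTableA_coarse (axDressK_blockCov hn hKcov) (coProj_translate hn hScov) c e)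
    (fun κ' l => constReproSum_colH_zero (σ := fun κ' l => if κ' = l then (((n : ℝ) ^ (4 + 1))⁻¹) else 0) hw0 κ' l)
    (fun κ' l => linReproSum_colH_zero hw1 κ' l) (fun κ' l => absMoment₂_colH_zero hwA κ' l)
    (fun c e b => absMoment₂_baseKer_bubbleTableA (axDressK n K) hA hS' hδs c e b)
    (hasSum_col_bubbleTableA hn hK hδ hS hδs hrow) hrow hT1 κ lam μ ν
  rw [← h, ← (Equiv.neg (Site 4)).tsum_eq]
  refine tsum_congr fun z => ?_
  rw [bubblePart_TPerfOf_eq_dressedEntryP hn hK hδ hKcov hS hδs hScov μ ν]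
  simp only [Equiv.neg_apply, Pi.neg_apply, neg_mul_neg, neg_neg]

/-- [folklore] The same in `B12Beta.secondMoment` currency (integrand order `T z · z_κ · z_λ`, no bond factor): the second moment of the bubble
half of `TPerfOf n K S W` is `n⁻⁸ · avgM2 n (P^Π μ ν) κ λ` — the bookkeeping constant of the owner's «Units check» DISPLAYED. -/
theorem secondMoment_bubblePart_TPerfOf_eq (hn : 1 ≤ n) (hK : Decays K C δ) (hδ : 0 < δ)
    (hKcov : ∀ t : Fin (3 + 1) → ℤ, shiftK (-((n : ℤ) • t)) K = K)
    (hw0 : ∀ κ l : Fin 4, ConstReproSum n (colOf K κ l) (if κ = l then (((n : ℝ) ^ (4 + 1))⁻¹) else 0))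
    (hw1 : ∀ κ l : Fin 4, ∃ C : Fin 4 → ℝ, LinReproSum n (colOf K κ l) C) (hwA : ∀ κ l : Fin 4, AbsMoment₂ (colOf K κ l))
    (hS : LocStencil S Cs δs) (hδs : 0 < δs) (hScov : ∀ κ u t, S κ (u + (n : ℤ) • t) = shiftK (-((n : ℤ) • t)) (S κ u))
    (hrow : ∀ (κ' l' : Fin 4) (b : Site 4), HasSum (bubbleTableA (axDressK n K) (coProj n S) κ' l' b) 0)
    (hT1 : ∀ (κ' l' μ' : Fin 4), ∑ r : Fin 4 → Fin n, ∑' t, (t μ' : ℝ) *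
      baseKer (bubbleTableA (axDressK n K) (coProj n S) κ' l') (resSite r) t = 0)
    (κ lam μ ν : Fin 4) :
    ∑' z : Site 4, (-(1 / 2 : ℝ) * bubble (axDressK n K) (axVertexOfK K n S μ 0) (axVertexOfK K n S ν z)) * (z κ : ℝ) * (z lam : ℝ)
      = ((n : ℝ) ^ 8)⁻¹ * avgM2 n (bubbleTableA (axDressK n K) (coProj n S) μ ν) κ lam := by
  have hn' : (n : ℝ) ^ 8 ≠ 0 := pow_ne_zero 8 (by exact_mod_cast (show n ≠ 0 by omega))
  have h := bondSecondMoment_bubblePart_TPerfOf_eq_avgM2 hn hK hδ hKcov hw0 hw1 hwA hS hδs hScov hrow hT1 κ lam μ ν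
  have e : (fun z : Site 4 => ((z κ * z lam : ℤ) : ℝ) * ((n : ℝ) ^ 8
      * (-(1 / 2 : ℝ) * bubble (axDressK n K) (axVertexOfK K n S μ 0) (axVertexOfK K n S ν z))))
      = fun z => (n : ℝ) ^ 8 * ((-(1 / 2 : ℝ) * bubble (axDressK n K) (axVertexOfK K n S μ 0) (axVertexOfK K n S ν z))
          * (z κ : ℝ) * (z lam : ℝ)) := by
    funext z
    push_cast
    ring
  rw [e, tsum_mul_left] at h
  rw [← h, ← mul_assoc, inv_mul_cancel₀ hn', one_mul]

end Transport

/-! ## §6 The perfect resolvent: every K-side hypothesis discharged from the tree -/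

section Perfect

variable {Lc : ℕ} [NeZero Lc]

/-- [folklore] Trivial Ward data for the ZERO kernel (to read the `EntryHyps` letters of the perfect column off `entryHyps_perfCol_holds`,
whose `𝒯`-argument is immaterial for the weight letters). -/
theorem entryHyps_perfCol_zero (hLc : 2 ≤ Lc) {m : ℕ} (hm : 1 ≤ m) :
    EntryHyps (Lc ^ m) (colOf (KPerf (d := 3) Lc (sfStep Lc) (smStep 3 Lc) m)) (0 : EKer 4) := by
  refine entryHyps_perfCol_holds hLc hm (fun c e => ?_) (fun c e => ?_) (fun c e μ => ?_)
  · have h0 : (fun y : Fin 4 → ℤ => (1 + l1 y ^ 2) * |(0 : EKer 4) c e y|) = fun _ => 0 := by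
      funext y; simp only [Pi.zero_apply, abs_zero, mul_zero]
    unfold DecimatedMomentSummable.AbsMoment₂
    rw [h0]; exact summable_zero
  · have h0 : ((0 : EKer 4) c e) = fun _ => 0 := rfl
    rw [h0]; exact hasSum_zero
  · have h0 : (fun t : Fin 4 → ℤ => t μ • (0 : EKer 4) c e t) = fun _ => 0 := by
      funext t; simp only [Pi.zero_apply, smul_zero]
    rw [h0]; exact hasSum_zero

/-- [folklore] **ALG-2 (EXACT FORM) AT THE PERFECT RESOLVENT, K-SIDE HYPOTHESIS-FREE** (`d = 3`, `2 ≤ Lc`, `m ≥ 1`, `n := Lc^m`, adopted units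
`(sfStep, smStep 3)`): with `K := KPerf Lc (sfStep Lc) (smStep 3 Lc) m` — decaying (`exists_decays_KPerf_holds`), coarse-translation invariant
(`FP/SymmetryK.shiftK_KPerf`), its column admissible (`entryHyps_perfCol_holds`) — and ANY local, coarse-translation-covariant stencil family `S`
whose `Π`-bubble table `P^Π := bubbleTableA (Π K Π) (Πᵀ S)` has Ward rows (`hrow`) and vanishing base-point-summed first moments (`hT1`):
`Σ'_z (−½·bubble (Π K Π) (V μ 0) (V ν z)) · z_κ z_λ = (Lc^m)⁻⁸ · avgM2 (Lc^m) (P^Π μ ν) κ λ`. -/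
theorem secondMoment_bubblePart_perfect_eq (hLc : 2 ≤ Lc) {m : ℕ} (hm : 1 ≤ m)
    {S : Fin (3 + 1) → (Fin (3 + 1) → ℤ) → MKer (3 + 1) (Fib 3)} {Cs δs : ℝ} (hS : LocStencil S Cs δs) (hδs : 0 < δs)
    (hScov : ∀ κ u t, S κ (u + ((Lc ^ m : ℕ) : ℤ) • t) = shiftK (-(((Lc ^ m : ℕ) : ℤ) • t)) (S κ u))
    (hrow : ∀ (κ' l' : Fin 4) (b : Site 4),
      HasSum (bubbleTableA (axDressK (Lc ^ m) (KPerf (d := 3) Lc (sfStep Lc) (smStep 3 Lc) m)) (coProj (Lc ^ m) S) κ' l' b) 0)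
    (hT1 : ∀ (κ' l' μ' : Fin 4), ∑ r : Fin 4 → Fin (Lc ^ m), ∑' t, (t μ' : ℝ) *
      baseKer (bubbleTableA (axDressK (Lc ^ m) (KPerf (d := 3) Lc (sfStep Lc) (smStep 3 Lc) m)) (coProj (Lc ^ m) S) κ' l')
        (resSite r) t = 0)
    (κ lam μ ν : Fin 4) :
    ∑' z : Site 4, (-(1 / 2 : ℝ) * bubble (axDressK (Lc ^ m) (KPerf (d := 3) Lc (sfStep Lc) (smStep 3 Lc) m))
        (axVertexOfK (KPerf (d := 3) Lc (sfStep Lc) (smStep 3 Lc) m) (Lc ^ m) S μ 0)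
        (axVertexOfK (KPerf (d := 3) Lc (sfStep Lc) (smStep 3 Lc) m) (Lc ^ m) S ν z)) * (z κ : ℝ) * (z lam : ℝ)
      = ((((Lc ^ m : ℕ) : ℝ)) ^ 8)⁻¹ *
          avgM2 (Lc ^ m) (bubbleTableA (axDressK (Lc ^ m) (KPerf (d := 3) Lc (sfStep Lc) (smStep 3 Lc) m)) (coProj (Lc ^ m) S) μ ν)
            κ lam := by
  have hn : 1 ≤ Lc ^ m := Nat.one_le_pow _ _ (by omega)
  obtain ⟨CK, δK, hδK, hK⟩ := exists_decays_KPerf_holds hLc hm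
  have hE := entryHyps_perfCol_zero hLc hm
  have h := secondMoment_bubblePart_TPerfOf_eq (n := Lc ^ m) hn hK hδK (fun t => shiftK_KPerf Lc (sfStep Lc) (smStep 3 Lc) m t)
    hE.const hE.lin hE.absW hS hδs (by exact_mod_cast hScov) hrow hT1 κ lam μ ν
  simpa using h

end Perfect

end

end Summit.QuantumFields.BalabanUV.Beta.FP.PerfectBubbleSandwich
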